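import Summits.NavierStokesRegularity.NavierStokesRegularity.Theses.AdaptedFrequency
import Literature.Analysis.FluidPDE.AdaptedBackwardKernel
import Literature.Analysis.FluidPDE.ClassicalSolution
import Summits.NavierStokesRegularity.NavierStokesRegularity.Theorems.AdaptedFrequencyTangentFlowTransferFrequencyTransfer
import Summits.NavierStokesRegularity.NavierStokesRegularity.Theorems.AdaptedFrequencyTangentFlowTransferFrequencyLimit
import HarnessLib

/-!
# Stub `stub_hullTransfer` of line `cloud-frame-effective-tsai`, part II: passage to the limit
# of the adapted enstrophy and of the adapted frequency along the blow-up sequence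
# (crux `AdaptedFrequencyConverges`, stmt-NavierStokesRegularity-10493)

Helper file (all results proved). The variant of `adaptedFrequency_limit_eq` (item
`TangentFlowTransfer`, stmt-10494) consumed by the hull transfer. Along a sequence
`(w_k, p_k, g_k)` of classical unit-viscosity solutions on windows `[A_k, 0)`, `A_k → −∞`,
Oseen-mild between window times, Type I with one constant, with adapted kernels `g_k` (pole
`(0,0)`) under one Gaussian, converging pointwise with two spatial derivatives (velocities) and
pointwise (kernels) to a classical `(W, q)` on `(−∞, 0)` with adapted kernel `K`, we prove for
every `τ < 0` — WITHOUT any hypothesis on the frequencies `Λ_k` —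

* `H_k(τ) → H̄(τ)` (dominated convergence, `tendsto_adaptedEnstrophy_of_tendsto`);
* if `H̄(τ) ≠ 0`, `Λ_k(τ) → Λ̄(τ)`: `H_k′ = ∫ (L‖ω_k‖²) g_k` is bounded uniformly on
  `U = (2τ, τ/2)` and converges to the continuous `ḡ = ∫ (L‖ω_W‖²) K`, so `H̄′ = ḡ` on `U`
  (`hasDerivAt_of_tendsto_of_deriv_bound`) and `(0 − τ) H_k′(τ)/H_k(τ) → (0 − τ) H̄′(τ)/H̄(τ)`.

This is what makes the frequency of the blow-up limit at `τ = −1` equal to the limit of the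
original frequencies `Λ(t_k)` along the zoom times, in the contradiction argument of the stub.
-/

noncomputable section

namespace Summit.NavierStokesRegularity.NavierStokesRegularity.Theorems.AdaptedFrequencyConverges.CloudFrameEffectiveTsai

open scoped Topology InnerProductSpace RealInnerProductSpace
open Literature.Analysis Literature.Analysis.FluidPDE Set Filter MeasureTheory Function

/-- Unshifting a limit along `j ↦ j + k₀`. [folklore] -/
theorem hullTransfer_tendsto_of_shift {α : Type*} [TopologicalSpace α] {f : ℕ → α} {a : α}
    (k₀ : ℕ) (h : Tendsto (fun j => f (j + k₀)) atTop (𝓝 a)) : Tendsto f atTop (𝓝 a) :=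
  (tendsto_add_atTop_iff_nat k₀).1 h

/-- **Passage to the limit of the adapted enstrophy and of the adapted frequency along the
blow-up sequence** (module docstring). Along a sequence `(w_k, p_k, g_k)` of classical
unit-viscosity solutions on windows `[A_k, 0)`, `A_k → −∞`, Oseen-mild between window times,
Type I with one constant, with adapted kernels `g_k` (pole `(0,0)`) under one Gaussian,
converging pointwise with two spatial derivatives (velocities) and pointwise (kernels) to a
classical `(W, q)` on `(−∞, 0)` with adapted kernel `K`: for every `τ < 0`,
`H_k(τ) → H̄(τ)`, and `Λ_k(τ) → Λ̄(τ)` provided `H̄(τ) ≠ 0`. [folklore] -/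
theorem hullTransfer_tendsto_enstrophy_frequency {C₀ : ℝ} (hC₀ : 0 ≤ C₀) {A : ℕ → ℝ}
    (hA : Tendsto A atTop atBot)
    {w : ℕ → ℝ → EuclideanSpace ℝ (Fin 3) → EuclideanSpace ℝ (Fin 3)}
    {pw : ℕ → ℝ → EuclideanSpace ℝ (Fin 3) → ℝ} {g : ℕ → ℝ → EuclideanSpace ℝ (Fin 3) → ℝ}
    (hcl : ∀ k, IsClassicalNSSolutionOn (Ico (A k) 0) 1 0 (w k) (pw k))
    (hmild : ∀ k, ∀ s t : ℝ, A k < s → s < t → t < 0 → ∀ x,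
      w k t x = UnboundedOperators.heatExtension (w k s) (t - s) x -
        oseenDuhamel 1 s (w k) (w k) t x)
    (hI : ∀ k, ∀ t ∈ Ioo (A k) 0, ∀ x, ‖w k t x‖ ≤ C₀ / Real.sqrt (-t))
    (hg : ∀ k, IsAdaptedBackwardKernel 1 (w k) (Ico (A k) 0) 0 0 (g k))
    {C₁ C₂ : ℝ} (hC₁ : 0 ≤ C₁) (hC₂ : 0 < C₂)
    (hgb : ∀ k, ∀ t ∈ Ico (A k) 0, ∀ x, g k t x ≤ C₁ * ((0:ℝ) - t) ^ (-(3:ℝ) / 2) *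
      Real.exp (-(‖x - (0 : EuclideanSpace ℝ (Fin 3))‖ ^ 2) / (C₂ * ((0:ℝ) - t))))
    {W : ℝ → EuclideanSpace ℝ (Fin 3) → EuclideanSpace ℝ (Fin 3)}
    {q : ℝ → EuclideanSpace ℝ (Fin 3) → ℝ} (hW : IsClassicalNSSolutionOn (Iio 0) 1 0 W q)
    {K : ℝ → EuclideanSpace ℝ (Fin 3) → ℝ} (hK : IsAdaptedBackwardKernel 1 W (Iio 0) 0 0 K)
    (hw1 : ∀ t < 0, ∀ x, Tendsto (fun k => fderiv ℝ (w k t) x) atTop (𝓝 (fderiv ℝ (W t) x)))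
    (hw2 : ∀ t < 0, ∀ x, Tendsto (fun k => fderiv ℝ (fderiv ℝ (w k t)) x) atTop
      (𝓝 (fderiv ℝ (fderiv ℝ (W t)) x)))
    (hgK : ∀ t < 0, ∀ x, Tendsto (fun k => g k t x) atTop (𝓝 (K t x))) {τ : ℝ} (hτ : τ < 0) :
    Tendsto (fun k => adaptedEnstrophy (w k) (g k) τ) atTop (𝓝 (adaptedEnstrophy W K τ)) ∧
      (adaptedEnstrophy W K τ ≠ 0 →
        Tendsto (fun k => adaptedFrequency (w k) (g k) 0 τ) atTop
          (𝓝 (adaptedFrequency W K 0 τ))) := by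
  -- the window `U = (2τ, τ/2)` and the shift `k₀` beyond which `A_k < 3τ`
  set U : Set ℝ := Ioo (2 * τ) (τ / 2) with hUdef
  have hUo : IsOpen U := isOpen_Ioo
  have hτU : τ ∈ U := ⟨by linarith, by linarith⟩
  have hUneg : ∀ t ∈ U, t < 0 := fun t ht => by linarith [ht.2]
  obtain ⟨k₀, hk₀⟩ : ∃ k₀ : ℕ, ∀ k ≥ k₀, A k < 3 * τ :=
    eventually_atTop.1 (hA.eventually (eventually_lt_atBot (3 * τ)))
  have hUsub : ∀ j, U ⊆ Ico (A (j + k₀)) 0 := fun j t ht =>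
    ⟨by linarith [hk₀ (j + k₀) (Nat.le_add_left _ _), ht.1], hUneg t ht⟩
  -- uniform `C³` bounds and enstrophy-density bounds on `U`, for the shifted sequence
  obtain ⟨M, _, hM⟩ := exists_slab_bounds_of_typeI_windows hC₀ hτ
  obtain ⟨B, hB⟩ := exists_enstrophyDensity_bounds (1 : ℝ) M
  have hclU : ∀ j, IsClassicalNSSolutionOn U 1 0 (w (j + k₀)) (pw (j + k₀)) := fun j =>
    (hcl _).mono (hUsub j) (uniqueDiffOn_Ioo _ _)
  have hbdU : ∀ j, ∀ t ∈ U, ∀ x, ‖w (j + k₀) t x‖ ≤ M ∧ ‖fderiv ℝ (w (j + k₀) t) x‖ ≤ M ∧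
      ‖iteratedFDeriv ℝ 2 (w (j + k₀) t) x‖ ≤ M ∧ ‖iteratedFDeriv ℝ 3 (w (j + k₀) t) x‖ ≤ M :=
    fun j => hM (hk₀ _ (Nat.le_add_left _ _)) (hcl _) (hmild _) (hI _)
  have hBU := fun j => hB (hclU j) (uniqueDiffOn_Ioo _ _) (hbdU j)
  have hgU : ∀ j, IsAdaptedBackwardKernel 1 (w (j + k₀)) U 0 0 (g (j + k₀)) := fun j =>
    (hg _).mono (hUsub j) (uniqueDiffOn_Ioo _ _)
  -- one Gaussian dominating all kernels on `U`
  set Φ₀ : EuclideanSpace ℝ (Fin 3) → ℝ := fun x => C₁ * ((0:ℝ) - τ / 2) ^ (-(3:ℝ) / 2) *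
    Real.exp (-(‖x - (0 : EuclideanSpace ℝ (Fin 3))‖ ^ 2) / ((4 * C₂) * ((0:ℝ) - τ / 2)))
    with hΦ₀def
  have hΦ₀ : Integrable Φ₀ (volume : Measure (EuclideanSpace ℝ (Fin 3))) :=
    integrable_gaussian_dom hC₂ hτ
  have hdomU : ∀ j, ∀ t ∈ U, ∀ x, g (j + k₀) t x ≤ Φ₀ x := fun j t ht x =>
    (hgb _ t (hUsub j ht) x).trans (gaussian_le_gaussian_of_mem_Ioo hC₁ hC₂ hτ ht x)
  -- eventual facts are facts for the shifted sequence
  have hshift : ∀ {P : ℕ → Prop}, (∀ j, P (j + k₀)) → ∀ᶠ k in atTop, P k := by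
    intro P h
    refine eventually_atTop.2 ⟨k₀, fun k hk => ?_⟩
    obtain ⟨j, rfl⟩ : ∃ j, k = j + k₀ := ⟨k - k₀, by omega⟩
    exact h j
  -- the limit kernel is dominated too, and the limit gradients are bounded by `M`
  have hKdom : ∀ t ∈ U, ∀ x, K t x ≤ Φ₀ x := fun t ht x =>
    le_of_tendsto (hgK t (hUneg t ht) x) (hshift fun j => hdomU j t ht x)
  -- slices
  have hw2U : ∀ j, ∀ t ∈ U, ContDiff ℝ 2 (w (j + k₀) t) := fun j t ht =>
    contDiff_infty.1 ((hclU j).contDiff_velocity ht) 2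
  have hW2U : ∀ t ∈ U, ContDiff ℝ 2 (W t) := fun t ht =>
    contDiff_infty.1 (hW.contDiff_velocity (hUneg t ht)) 2
  have hMW : ∀ t ∈ U, ∀ x, ‖fderiv ℝ (W t) x‖ ≤ max M (‖curlCLM‖ * M) ∧
      ‖fderiv ℝ (curl (W t)) x‖ ≤ max M (‖curlCLM‖ * M) := by
    intro t ht x
    have h1n := ((hw1 t (hUneg t ht) x).comp (tendsto_add_atTop_nat k₀)).norm
    have h2n := (tendsto_fderiv_curl (fun j => hw2U j t ht) (hW2U t ht)
      ((hw2 t (hUneg t ht) x).comp (tendsto_add_atTop_nat k₀))).norm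
    refine ⟨(le_of_tendsto h1n (Eventually.of_forall fun j => (hbdU j t ht x).2.1)).trans
      (le_max_left _ _), (le_of_tendsto h2n (Eventually.of_forall fun j => ?_)).trans
      (le_max_right _ _)⟩
    exact (norm_fderiv_curl_le (hw2U j t ht) x).trans
      (mul_le_mul_of_nonneg_left (hbdU j t ht x).2.2.1 (norm_nonneg curlCLM))
  -- the players of `hasDerivAt_of_tendsto_of_deriv_bound`
  set H : ℕ → ℝ → ℝ := fun j => adaptedEnstrophy (w (j + k₀)) (g (j + k₀)) with hHdef
  set Hbar : ℝ → ℝ := adaptedEnstrophy W K with hHbar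
  set Ld : ℕ → ℝ → EuclideanSpace ℝ (Fin 3) → ℝ := fun j t x =>
    2 * ⟪curl (w (j + k₀) t) x, fderiv ℝ (w (j + k₀) t) x (curl (w (j + k₀) t) x)⟫ -
      2 * (1:ℝ) * frobeniusNormSq (fderiv ℝ (curl (w (j + k₀) t)) x) with hLd
  set LW : ℝ → EuclideanSpace ℝ (Fin 3) → ℝ := fun t x =>
    2 * ⟪curl (W t) x, fderiv ℝ (W t) x (curl (W t) x)⟫ -
      2 * (1:ℝ) * frobeniusNormSq (fderiv ℝ (curl (W t)) x) with hLW
  set gbar : ℝ → ℝ := fun t => ∫ x, LW t x * K t x with hgbar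
  -- derivative of `H_j` on `U`
  have hderiv : ∀ j, ∀ t ∈ U, HasDerivAt (H j) (∫ x, Ld j t x * g (j + k₀) t x) t :=
    fun j t ht => hasDerivAt_adaptedEnstrophy_window (hclU j) (hgU j) hΦ₀ (hdomU j) (hBU j) ht
  have hdiff : ∀ j, ∀ t ∈ U, DifferentiableAt ℝ (H j) t := fun j t ht =>
    (hderiv j t ht).differentiableAt
  have hderiv_eq : ∀ j, ∀ t ∈ U, deriv (H j) t = ∫ x, Ld j t x * g (j + k₀) t x :=
    fun j t ht => (hderiv j t ht).deriv
  -- uniform bound on `H_j′`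
  have hbound : ∀ j, ∀ t ∈ U, |deriv (H j) t| ≤ B + B * B + |(1:ℝ)| * B := by
    intro j t ht
    rw [hderiv_eq j t ht]
    exact abs_integral_opLDensity_mul_le (hclU j) (uniqueDiffOn_Ioo _ _) (hgU j) (hBU j) ht
  have hgcU : ∀ j, ∀ t ∈ U, Continuous (g (j + k₀) t) := fun j t ht =>
    ((hgU j).contDiff_slice ht).continuous
  -- `H_j → H̄` on `U`
  have hH : ∀ t ∈ U, Tendsto (fun j => H j t) atTop (𝓝 (Hbar t)) := by
    intro t ht
    refine tendsto_adaptedEnstrophy_of_tendsto (fun j => (hw2U j t ht).of_le (by norm_num))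
      (fun j => hgcU j t ht) (B := B) (fun j x => ?_) hΦ₀
      (fun j x => ⟨((hgU j).pos t ht x).le, hdomU j t ht x⟩)
      (fun x => (hw1 t (hUneg t ht) x).comp (tendsto_add_atTop_nat k₀))
      (fun x => (hgK t (hUneg t ht) x).comp (tendsto_add_atTop_nat k₀))
    exact le_of_abs_le (hBU j t ht x).1
  -- `H_j′ → ḡ` on `U`
  have hg' : ∀ t ∈ U, Tendsto (fun j => deriv (H j) t) atTop (𝓝 (gbar t)) := by
    intro t ht
    have e : (fun j => deriv (H j) t) = fun j => ∫ x, Ld j t x * g (j + k₀) t x :=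
      funext fun j => hderiv_eq j t ht
    rw [e]
    refine tendsto_integral_opLDensity_of_tendsto (ν := 1) (fun j => hw2U j t ht) (hW2U t ht)
      (fun j => hgcU j t ht) (B := B + B * B + |(1:ℝ)| * B) (fun j x => ?_) hΦ₀
      (fun j x => ⟨((hgU j).pos t ht x).le, hdomU j t ht x⟩)
      (fun x => (hw1 t (hUneg t ht) x).comp (tendsto_add_atTop_nat k₀))
      (fun x => (hw2 t (hUneg t ht) x).comp (tendsto_add_atTop_nat k₀))
      (fun x => (hgK t (hUneg t ht) x).comp (tendsto_add_atTop_nat k₀))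
    exact abs_opLDensity_le (hclU j) (uniqueDiffOn_Ioo _ _) (hBU j) ht x
  -- `ḡ` is continuous on `U`
  have hgc : ContinuousOn gbar U :=
    continuousOn_integral_opLDensity (ν := 1) hUo (hW.smooth_velocity.mono fun t ht => hUneg t ht)
      (hK.contDiffOn.mono (prod_mono (fun t ht => hUneg t ht) Subset.rfl))
      (fun t ht x => (hK.pos t (hUneg t ht) x).le) hΦ₀ hKdom hMW
  -- the derivative of the limit enstrophy at `τ`
  have hD : HasDerivAt Hbar (gbar τ) τ :=
    hasDerivAt_of_tendsto_of_deriv_bound hUo hdiff hbound hH hg' hgc hτU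
  refine ⟨hullTransfer_tendsto_of_shift k₀ (hH τ hτU), fun hne => ?_⟩
  -- the frequencies along the shifted sequence
  have h1 : Tendsto (fun j => (0 - τ) * deriv (H j) τ / H j τ) atTop
      (𝓝 ((0 - τ) * gbar τ / Hbar τ)) :=
    (((hg' τ hτU).const_mul (0 - τ)).div (hH τ hτU) hne)
  have h2 : adaptedFrequency W K 0 τ = (0 - τ) * gbar τ / Hbar τ := by
    rw [adaptedFrequency_apply, hD.deriv]
  rw [h2]
  refine hullTransfer_tendsto_of_shift k₀ ?_
  have e : (fun j => adaptedFrequency (w (j + k₀)) (g (j + k₀)) 0 τ) =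
      fun j => (0 - τ) * deriv (H j) τ / H j τ := by
    funext j
    rw [adaptedFrequency_apply]
  rw [e]
  exact h1

end Summit.NavierStokesRegularity.NavierStokesRegularity.Theorems.AdaptedFrequencyConverges.CloudFrameEffectiveTsai

end
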